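import Summits.MatrixMultiplication.OmegaCensus.ThreeSetZpFrame4
import HarnessLib

/-!
# Three-set cube cells `(4, d, e)@p²` (`Dih(ℤ_p²)`): the cell modulo a W-cover and the killer facts — generic `p`

ω-census `pub-omega`, family (b3), seat pub-omega-group gen 39.  Framing: lottery ticket; floor = certified bounds/negative ranges.
VALUE: the generic assembly of the W-level kernel route (`ThreeSetZpFrame4`): given a W-COVER (`hcov`, decided per `p`) and the SEMANTIC
killer facts (`hkill`: no killer line datum admits a solution of the three-set line identity at fibre `p` — obtained per cell from
`LineInv.noSol3Chk_sound` / `noSol3ChkQ_sound` applied to `decide`d chunks), there is no cube symmetric form with `|W| = 4`, `|X| = d`,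
`|Y| = e` over `|A| = p²`, `A ↠ ℤ_p²`, hence no TPP triple of a dihedral-like group over `A` with balanced coset parts `(4,4 | d,d | e,e)`
attaining `3|S||T||U| + 8 = 8|A|`.  Instances: `(4,4,6)@289` (`ThreeSetZ17Cells446`, this seat), next `(4,5,6)@361`, `(4,4,11)@529`.
NOT progress on ω.
-/

namespace Summit.MatrixMultiplication.OmegaCensus

open Finset ZpZpDomino ZpFrame4

section Core

variable {p : ℕ} [Fact p.Prime] {A : Type*} [AddCommGroup A] [Fintype A] [DecidableEq A]

/-- **W-normalisation + core**: a cube symmetric form with `|W| = 4` over `|A| = p²`, `A ↠ ℤ_p²`, with a W-cover, solves the line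
identity on a killer. [folklore] -/
theorem exists_killer_line_of_cube_form_4_sq (hp5 : 5 ≤ p) {d e nk : ℕ} (KILS : List (List ℕ))
    (hcov : ∀ ci, ci < p * p → ¬(ci = 0 ∨ ci = 1 ∨ ci = p) →
      ∃ a b β k : ℕ, (a ≠ 0 ∨ b ≠ 0) ∧ a < p ∧ b < p ∧ β < p ∧ k < nk ∧ ∀ v, v < p →
        ((if β % p = v then 1 else 0) + (if (a + β) % p = v then 1 else 0) + (if (b + β) % p = v then 1 else 0) +
          (if (a * (ci / p) + b * (ci % p) + β) % p = v then 1 else 0)) = (KILS.getD k []).getD v 0)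
    (hA : Fintype.card A = p * p) (Φ : A →+ ZMod p × ZMod p)
    (hΦ : Function.Surjective Φ) {W X Y : Finset A} {x₀ : A} (hW : W.card = 4) (hX : X.card = d) (hY : Y.card = e)
    (h₁ : Set.InjOn (fun p : A × A × A => -p.1 + p.2.1 + p.2.2) ↑(W ×ˢ X ×ˢ Y))
    (h₂ : Set.InjOn (fun p : A × A × A => p.1 - p.2.1 + p.2.2) ↑(W ×ˢ X ×ˢ Y))
    (h₃ : Set.InjOn (fun p : A × A × A => p.1 + p.2.1 - p.2.2) ↑(W ×ˢ X ×ˢ Y))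
    (d₁₂ : Disjoint ((W ×ˢ X ×ˢ Y).image fun p : A × A × A => -p.1 + p.2.1 + p.2.2)
      ((W ×ˢ X ×ˢ Y).image fun p : A × A × A => p.1 - p.2.1 + p.2.2))
    (d₁₃ : Disjoint ((W ×ˢ X ×ˢ Y).image fun p : A × A × A => -p.1 + p.2.1 + p.2.2)
      ((W ×ˢ X ×ˢ Y).image fun p : A × A × A => p.1 + p.2.1 - p.2.2))
    (d₂₃ : Disjoint ((W ×ˢ X ×ˢ Y).image fun p : A × A × A => p.1 - p.2.1 + p.2.2)
      ((W ×ˢ X ×ˢ Y).image fun p : A × A × A => p.1 + p.2.1 - p.2.2))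
    (hcover : ((W ×ˢ X ×ˢ Y).image fun p : A × A × A => -p.1 + p.2.1 + p.2.2) ∪
      ((W ×ˢ X ×ˢ Y).image fun p : A × A × A => p.1 - p.2.1 + p.2.2) ∪
      ((W ×ˢ X ×ˢ Y).image fun p : A × A × A => p.1 + p.2.1 - p.2.2) = univ.erase x₀) :
    ∃ k, k < nk ∧ ∃ Fl : List ℕ, Fl ∈ ZpZpDomino.compsLit p d ∧ ∃ (G : ZMod p → ℕ) (s : ZMod p), (∀ u, G u ≤ e) ∧
      ∀ τ : ZMod p, (∑ u : ZMod p, lineMat3 (vecFn (KILS.getD k [])) (vecFn Fl) τ u * G u) +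
        (if s = τ then 1 else 0) = p := by
  classical
  have hWne : W.Nonempty := by rw [← card_pos, hW]; norm_num
  obtain ⟨w₀, hw₀⟩ := hWne
  have hW3 : (W.erase w₀).card = 3 := by rw [card_erase_of_mem hw₀, hW]
  obtain ⟨w₁, w₂, w₃, h12, h13, h23, hWe⟩ := card_eq_three.1 hW3
  have hm : ∀ x, x ∈ W.erase w₀ ↔ x = w₁ ∨ x = w₂ ∨ x = w₃ := fun x => by rw [hWe]; simp
  have h01 : w₀ ≠ w₁ := fun e => by have := (hm w₁).2 (Or.inl rfl); rw [← e] at this; simp at this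
  have h02 : w₀ ≠ w₂ := fun e => by have := (hm w₂).2 (Or.inr (Or.inl rfl)); rw [← e] at this; simp at this
  have h03 : w₀ ≠ w₃ := fun e => by have := (hm w₃).2 (Or.inr (Or.inr rfl)); rw [← e] at this; simp at this
  have hWeq : W = {w₀, w₁, w₂, w₃} := by rw [← insert_erase hw₀, hWe]
  obtain ⟨t₁, t₂, t₃, e₁₂, e₁₃, e₂₃, tcov, cW, cX, cY⟩ :=
    cube_symmetric_form_translate h₁ h₂ h₃ d₁₂ d₁₃ d₂₃ hcover (-w₀)
  set W' := W.image (· + -w₀) with hW'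
  set X' := X.image (· + -w₀) with hX'
  set Y' := Y.image (· + -w₀) with hY'
  set u₁ := w₁ - w₀ with hu₁
  set u₂ := w₂ - w₀ with hu₂
  set u₃ := w₃ - w₀ with hu₃
  have hWt : W' = {0, u₁, u₂, u₃} := by
    rw [hW', hWeq, image_insert, image_insert, image_insert, image_singleton, add_neg_cancel, hu₁, hu₂, hu₃,
      sub_eq_add_neg, sub_eq_add_neg, sub_eq_add_neg]
  have h10 : u₁ ≠ 0 := sub_ne_zero.2 (Ne.symm h01)
  have h20 : u₂ ≠ 0 := sub_ne_zero.2 (Ne.symm h02)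
  have h30 : u₃ ≠ 0 := sub_ne_zero.2 (Ne.symm h03)
  have h12' : u₁ ≠ u₂ := fun e => h12 (sub_left_injective e)
  have h13' : u₁ ≠ u₃ := fun e => h13 (sub_left_injective e)
  have h23' : u₂ ≠ u₃ := fun e => h23 (sub_left_injective e)
  have hXc : X'.card = d := by rw [cX, hX]
  have hYc : Y'.card = e := by rw [cY, hY]
  by_cases hD12 : (Φ u₁).1 * (Φ u₂).2 - (Φ u₁).2 * (Φ u₂).1 = 0
  · by_cases hD13 : (Φ u₁).1 * (Φ u₃).2 - (Φ u₁).2 * (Φ u₃).1 = 0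
    · by_cases hD23 : (Φ u₂).1 * (Φ u₃).2 - (Φ u₂).2 * (Φ u₃).1 = 0
      · exfalso
        obtain ⟨ab, hab, hau, hav, haw⟩ := exists_form_of_dets_eq_zero (Φ u₁) (Φ u₂) (Φ u₃) hD12 hD13 hD23
        have habne : ab.1 ≠ 0 ∨ ab.2 ≠ 0 := by
          by_contra hc
          push Not at hc
          exact hab (Prod.ext hc.1 hc.2)
        set ψ : A →+ ZMod p := (lmap ab.1 ab.2).comp Φ with hψ
        have hψs : Function.Surjective ψ := (lmap_surjective_of_ne habne).comp hΦ
        have hH : ψ.ker ≠ ⊤ := by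
          intro htop
          obtain ⟨x, hx⟩ := hψs 1
          have hmem : x ∈ ψ.ker := by rw [htop]; exact AddSubgroup.mem_top x
          rw [AddMonoidHom.mem_ker] at hmem
          exact absurd (hx.symm.trans hmem) one_ne_zero
        have hcard := card_eq_one_of_subset_coset t₁ t₂ t₃ e₁₂ e₁₃ e₂₃ tcov ψ.ker hH 0 (fun w hw => by
          rw [sub_zero, AddMonoidHom.mem_ker]
          rw [hWt] at hw
          simp only [mem_insert, mem_singleton] at hw
          rcases hw with rfl | rfl | rfl | rfl
          · exact map_zero ψ
          · show lmap ab.1 ab.2 (Φ u₁) = 0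
            rw [lmap_apply]; exact hau
          · show lmap ab.1 ab.2 (Φ u₂) = 0
            rw [lmap_apply]; exact hav
          · show lmap ab.1 ab.2 (Φ u₃) = 0
            rw [lmap_apply]; exact haw)
        rw [cW, hW] at hcard
        omega
      · have hWt' : W' = {0, u₂, u₃, u₁} := by
          rw [hWt]; ext x; simp only [mem_insert, mem_singleton]; tauto
        exact exists_killer_line_core hp5 KILS hcov hA Φ hΦ hWt' h20 h30 h10 h23' h12'.symm h13'.symm hD23 hXc hYc t₁ t₂ t₃
          e₁₂ e₁₃ e₂₃ tcov
    · have hWt' : W' = {0, u₁, u₃, u₂} := by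
        rw [hWt]; ext x; simp only [mem_insert, mem_singleton]; tauto
      exact exists_killer_line_core hp5 KILS hcov hA Φ hΦ hWt' h10 h30 h20 h13' h12' h23'.symm hD13 hXc hYc t₁ t₂ t₃ e₁₂
        e₁₃ e₂₃ tcov
  · exact exists_killer_line_core hp5 KILS hcov hA Φ hΦ hWt h10 h20 h30 h12' h13' h23' hD12 hXc hYc t₁ t₂ t₃ e₁₂ e₁₃ e₂₃ tcov

/-- **No cube symmetric form with `|W| = 4`, `|X| = d`, `|Y| = e` over `|A| = p²`, `A ↠ ℤ_p²`** — given a W-cover and the killer facts.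
[folklore] -/
theorem no_cube_form_4_sq_of_killers (hp5 : 5 ≤ p) {d e nk : ℕ} (KILS : List (List ℕ))
    (hcov : ∀ ci, ci < p * p → ¬(ci = 0 ∨ ci = 1 ∨ ci = p) →
      ∃ a b β k : ℕ, (a ≠ 0 ∨ b ≠ 0) ∧ a < p ∧ b < p ∧ β < p ∧ k < nk ∧ ∀ v, v < p →
        ((if β % p = v then 1 else 0) + (if (a + β) % p = v then 1 else 0) + (if (b + β) % p = v then 1 else 0) +
          (if (a * (ci / p) + b * (ci % p) + β) % p = v then 1 else 0)) = (KILS.getD k []).getD v 0)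
    (hkill : ∀ k, k < nk → ∀ Fl ∈ ZpZpDomino.compsLit p d, ∀ (G : ZMod p → ℕ) (s : ZMod p), (∀ u, G u ≤ e) →
      ¬ ∀ τ : ZMod p, (∑ u : ZMod p, lineMat3 (vecFn (KILS.getD k [])) (vecFn Fl) τ u * G u) + (if s = τ then 1 else 0) = p)
    (hA : Fintype.card A = p * p) (Φ : A →+ ZMod p × ZMod p)
    (hΦ : Function.Surjective Φ) {W X Y : Finset A} {x₀ : A} (hW : W.card = 4) (hX : X.card = d) (hY : Y.card = e)
    (h₁ : Set.InjOn (fun p : A × A × A => -p.1 + p.2.1 + p.2.2) ↑(W ×ˢ X ×ˢ Y))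
    (h₂ : Set.InjOn (fun p : A × A × A => p.1 - p.2.1 + p.2.2) ↑(W ×ˢ X ×ˢ Y))
    (h₃ : Set.InjOn (fun p : A × A × A => p.1 + p.2.1 - p.2.2) ↑(W ×ˢ X ×ˢ Y))
    (d₁₂ : Disjoint ((W ×ˢ X ×ˢ Y).image fun p : A × A × A => -p.1 + p.2.1 + p.2.2)
      ((W ×ˢ X ×ˢ Y).image fun p : A × A × A => p.1 - p.2.1 + p.2.2))
    (d₁₃ : Disjoint ((W ×ˢ X ×ˢ Y).image fun p : A × A × A => -p.1 + p.2.1 + p.2.2)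
      ((W ×ˢ X ×ˢ Y).image fun p : A × A × A => p.1 + p.2.1 - p.2.2))
    (d₂₃ : Disjoint ((W ×ˢ X ×ˢ Y).image fun p : A × A × A => p.1 - p.2.1 + p.2.2)
      ((W ×ˢ X ×ˢ Y).image fun p : A × A × A => p.1 + p.2.1 - p.2.2))
    (hcover : ((W ×ˢ X ×ˢ Y).image fun p : A × A × A => -p.1 + p.2.1 + p.2.2) ∪
      ((W ×ˢ X ×ˢ Y).image fun p : A × A × A => p.1 - p.2.1 + p.2.2) ∪
      ((W ×ˢ X ×ˢ Y).image fun p : A × A × A => p.1 + p.2.1 - p.2.2) = univ.erase x₀) : False := by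
  obtain ⟨k, hk, Fl, hFl, G, s, hG, hid⟩ :=
    exists_killer_line_of_cube_form_4_sq hp5 KILS hcov hA Φ hΦ hW hX hY h₁ h₂ h₃ d₁₂ d₁₃ d₂₃ hcover
  exact hkill k hk Fl hFl G s hG hid

end Core

/-! ## The TPP statements (modulo the cover and the killer facts) -/

section DihedralLike

variable {p : ℕ} [Fact p.Prime] {A : Type} [AddCommGroup A] [DecidableEq A] [Fintype A] {G : Type} [Group G] [DecidableEq G]
  {ρ τ : A → G} {c₀ : A} {S T U : Finset G}

open Literature.Combinatorics.Additive

/-- **No `(4,4 | d,d | e,e)` law triple over `|A| = p²`, `A ↠ ℤ_p²`** (dihedral-like `G`, any `c₀`; `12de + 1 = p²`) — given a W-cover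
and the killer facts. [folklore] -/
theorem no_law_cube_4de_sq_of_killers (hp5 : 5 ≤ p) {d e nk : ℕ} (hde : 12 * (d * e) + 1 = p * p) (KILS : List (List ℕ))
    (hcov : ∀ ci, ci < p * p → ¬(ci = 0 ∨ ci = 1 ∨ ci = p) →
      ∃ a b β k : ℕ, (a ≠ 0 ∨ b ≠ 0) ∧ a < p ∧ b < p ∧ β < p ∧ k < nk ∧ ∀ v, v < p →
        ((if β % p = v then 1 else 0) + (if (a + β) % p = v then 1 else 0) + (if (b + β) % p = v then 1 else 0) +
          (if (a * (ci / p) + b * (ci % p) + β) % p = v then 1 else 0)) = (KILS.getD k []).getD v 0)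
    (hkill : ∀ k, k < nk → ∀ Fl ∈ ZpZpDomino.compsLit p d, ∀ (G : ZMod p → ℕ) (s : ZMod p), (∀ u, G u ≤ e) →
      ¬ ∀ τ : ZMod p, (∑ u : ZMod p, lineMat3 (vecFn (KILS.getD k [])) (vecFn Fl) τ u * G u) + (if s = τ then 1 else 0) = p)
    (hA : Fintype.card A = p * p)
    (hρρ : ∀ a b, ρ a * ρ b = ρ (a + b)) (hρτ : ∀ a b, ρ a * τ b = τ (b - a))
    (hτρ : ∀ a b, τ a * ρ b = τ (a + b)) (hττ : ∀ a b, τ a * τ b = ρ (c₀ + b - a))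
    (hρ : Function.Injective ρ) (hτ : Function.Injective τ) (hne : ∀ a b, ρ a ≠ τ b)
    (hsurj : ∀ g, (∃ a, ρ a = g) ∨ (∃ a, τ a = g))
    (Φ : A →+ ZMod p × ZMod p) (hΦ : Function.Surjective Φ)
    (h : TripleProductProperty S T U)
    (hS₀ : (univ.filter fun a : A => ρ a ∈ S).card = 4) (hS₁ : (univ.filter fun a : A => τ a ∈ S).card = 4)
    (hT₀ : (univ.filter fun a : A => ρ a ∈ T).card = d) (hT₁ : (univ.filter fun a : A => τ a ∈ T).card = d)
    (hU : (univ.filter fun a : A => ρ a ∈ U).card = (univ.filter fun a : A => τ a ∈ U).card)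
    (hV : 3 * (S.card * T.card * U.card) + 8 = 8 * Fintype.card A) : False := by
  classical
  have hp2 : p ≠ 2 := by omega
  have hodd : Odd p := (Fact.out : p.Prime).odd_of_ne_two hp2
  have hhalf : ∀ c : A, ∃ a : A, a + a = c := exists_add_self_eq_of_card_odd (by rw [hA]; exact hodd.mul hodd)
  obtain ⟨W, X, Y, x₀, hWc, hXc, hYc, i₁, i₂, i₃, d₁₂, d₁₃, d₂₃, hcover⟩ :=
    cube_symmetric_form_of_law hρρ hρτ hτρ hττ hρ hτ hne hsurj hhalf h (by rw [hS₀, hS₁]) (by rw [hT₀, hT₁]) hU hV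
  rw [hS₀] at hWc
  rw [hT₀] at hXc
  have cS := card_eq_parts' hρ hτ hne hsurj S
  have cT := card_eq_parts' hρ hτ hne hsurj T
  have cU := card_eq_parts' hρ hτ hne hsurj U
  rw [hS₀, hS₁] at cS
  rw [hT₀, hT₁] at cT
  rw [← hU, ← hYc] at cU
  have hYe : Y.card = e := by
    rw [cS, cT, cU, hA, ← hde] at hV
    have h1 : 12 * (d * Y.card) = 12 * (d * e) := by nlinarith
    have h2 : d * Y.card = d * e := by omega
    rcases Nat.eq_zero_or_pos d with hd | hd
    · exfalso; rw [hd] at hde; simp at hde; nlinarith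
    · exact Nat.eq_of_mul_eq_mul_left hd h2
  exact no_cube_form_4_sq_of_killers hp5 KILS hcov hkill hA Φ hΦ hWc hXc hYe i₁ i₂ i₃ d₁₂ d₁₃ d₂₃ hcover

/-- **Cell form `(4,d,·)@p²` in all orderings**: balanced coset parts with a part `4` next to a part `d` (cyclically, either order) ⇒
`3|S||T||U| + 8 ≠ 8|A|` over `|A| = p²`, `A ↠ ℤ_p²` — given a W-cover and the killer facts. [folklore] -/
theorem no_law_cube_four_d_sq_of_killers (hp5 : 5 ≤ p) {d e nk : ℕ} (hde : 12 * (d * e) + 1 = p * p) (KILS : List (List ℕ))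
    (hcov : ∀ ci, ci < p * p → ¬(ci = 0 ∨ ci = 1 ∨ ci = p) →
      ∃ a b β k : ℕ, (a ≠ 0 ∨ b ≠ 0) ∧ a < p ∧ b < p ∧ β < p ∧ k < nk ∧ ∀ v, v < p →
        ((if β % p = v then 1 else 0) + (if (a + β) % p = v then 1 else 0) + (if (b + β) % p = v then 1 else 0) +
          (if (a * (ci / p) + b * (ci % p) + β) % p = v then 1 else 0)) = (KILS.getD k []).getD v 0)
    (hkill : ∀ k, k < nk → ∀ Fl ∈ ZpZpDomino.compsLit p d, ∀ (G : ZMod p → ℕ) (s : ZMod p), (∀ u, G u ≤ e) →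
      ¬ ∀ τ : ZMod p, (∑ u : ZMod p, lineMat3 (vecFn (KILS.getD k [])) (vecFn Fl) τ u * G u) + (if s = τ then 1 else 0) = p)
    (hA : Fintype.card A = p * p)
    (hρρ : ∀ a b, ρ a * ρ b = ρ (a + b)) (hρτ : ∀ a b, ρ a * τ b = τ (b - a))
    (hτρ : ∀ a b, τ a * ρ b = τ (a + b)) (hττ : ∀ a b, τ a * τ b = ρ (c₀ + b - a))
    (hρ : Function.Injective ρ) (hτ : Function.Injective τ) (hne : ∀ a b, ρ a ≠ τ b)
    (hsurj : ∀ g, (∃ a, ρ a = g) ∨ (∃ a, τ a = g))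
    (Φ : A →+ ZMod p × ZMod p) (hΦ : Function.Surjective Φ)
    (h : TripleProductProperty S T U)
    (hS : (univ.filter fun a : A => ρ a ∈ S).card = (univ.filter fun a : A => τ a ∈ S).card)
    (hT : (univ.filter fun a : A => ρ a ∈ T).card = (univ.filter fun a : A => τ a ∈ T).card)
    (hU : (univ.filter fun a : A => ρ a ∈ U).card = (univ.filter fun a : A => τ a ∈ U).card)
    (h4d : ((univ.filter fun a : A => ρ a ∈ S).card = 4 ∧ (univ.filter fun a : A => ρ a ∈ T).card = d) ∨
      ((univ.filter fun a : A => ρ a ∈ T).card = 4 ∧ (univ.filter fun a : A => ρ a ∈ U).card = d) ∨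
      ((univ.filter fun a : A => ρ a ∈ U).card = 4 ∧ (univ.filter fun a : A => ρ a ∈ S).card = d) ∨
      ((univ.filter fun a : A => ρ a ∈ S).card = d ∧ (univ.filter fun a : A => ρ a ∈ T).card = 4) ∨
      ((univ.filter fun a : A => ρ a ∈ T).card = d ∧ (univ.filter fun a : A => ρ a ∈ U).card = 4) ∨
      ((univ.filter fun a : A => ρ a ∈ U).card = d ∧ (univ.filter fun a : A => ρ a ∈ S).card = 4)) :
    3 * (S.card * T.card * U.card) + 8 ≠ 8 * Fintype.card A :=
  no_law_cube_two_parts_of_ordered 4 d (fun h' hS₀ hS₁ hT₀ hT₁ hU' hV' =>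
    no_law_cube_4de_sq_of_killers hp5 hde KILS hcov hkill hA hρρ hρτ hτρ hττ hρ hτ hne hsurj Φ hΦ h' hS₀ hS₁ hT₀ hT₁ hU' hV')
    h hS hT hU h4d

end DihedralLike

end Summit.MatrixMultiplication.OmegaCensus
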